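/-
Copyright: public-audit package `pub-balaban` (b2b-balaban), seat pv16-g21. Released under Apache 2.0 like Mathlib.
-/
import Literature.MathematicalPhysics.QuantumFieldTheory.Balaban1983to89.T4WilsonOddInsert

/-!
# `Balaban1983to89.T4WilsonPathInsert` — MULTI-LINK (PATH ∕ WORD) INSERTS, END TO END: the real part of a quaternion
# WORD `Re(c₀ · U(b₁)^{±} · c₁ · U(b₂)^{±} ⋯ U(b_m)^{±} · c_m)` through `m` DISTINCT links of the patch `s` (fixed
# cofactors `‖c_l‖ ≤ 1` = the frozen links of a lattice path multiplied out; `U^{−} = U*` a reversed link) has its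
# insert binders of `T4WilsonResponseJunction` (measurable `hBm` ∕ bounded `hR` ∕ chart-`C¹` with the EXPLICIT gradient
# budget `|∇|² ≤ m·(1+ρ+ρ²)²` `hBg`) DISCHARGED BY PROOF, and — since a word of length `≥ 2` is NOT inversion-odd —
# the `MeanVanishes` datum is supplied instead by CENTRING the insert at the reference exterior, so that the (CM)
# channel bound (I6) in the (β) currency about the FLAT field becomes the CLOSED statement
# `condMean_channel_wilson_path_centred_flat` (cell T4, node O3b; row `T4-O3.E-i′-β-CONVRESP-PATHINSERT*`, Q24(a)
# self-row of lineage pv16 generation 21)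

HONEST FRAMING.  Audit cell `pub-balaban`, unit `b2b-balaban-pv16-g21` (SURGE NODE PROVER #16; companion record
`HOME/t4/T4-EST-O3Ei1.md` §4n).  The cell's T4 target is the existence and uniqueness of the continuum limit of
unit-scale averaged loop expectations on a FINITE torus, with Bałaban's densities as GIVEN data satisfying the printed
end statement (B) as a HYPOTHESIS; it is NOT an infinite-volume statement, NOT a mass gap, NOT the Clay problem, and
this module is NOT progress on any summit.  Value = kernel-checked bookkeeping and nothing more: noncommutative
polynomial algebra in `ℍ`, multivariable calculus on `ℝⁿ = ⊕_b ℝ³`, and the specialisation of theorems already in the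
tree.  `T4WilsonOddInsert` (v1, p192959) ran ONE-LINK inserts `Re(su2Quat(y_b) · d)` through the four insert binders of
`T4WilsonResponseJunction` and recorded as HONEST SCOPE (b) that multi-link inserts — `Re tr` of a path through several
links of `s` — were NOT treated.  THIS MODULE treats them: (i) §1 the QUATERNION WORD `wordProd m σ c q =
c₀ · q₀^{σ₀} · c₁ ⋯ q_{m−1}^{σ_{m−1}} · c_m` (`q^{true} = q`, `q^{false} = q*`), its submultiplicativity `‖w‖ ≤ 1`, its
SLOT STRUCTURE `w(q ← p at k) = L · p^{σ_k} · R` (`‖L‖, ‖R‖ ≤ 1`) whence `Re w(q ← p at k) = Re(p · a)` with `‖a‖ ≤ 1`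
INDEPENDENT of `p`, smoothness in the letters and measurability on `SU(2)^m`; (ii) §2 the BLOCK-INSERTION calculus on
`ℝⁿ = ⊕_b ℝᵐ` (`x ←_b v`, its linear part `ι_b`, the chain rule `D_v g(x ←_b v) u = Dg(x)(ι_b u)`, the identity
`|∇g(x)|² = Σ_b |∇_b g(x)|²` and the bound `|∇g(x)|² ≤ |T|·G²` for a function of the blocks in `T` only); (iii) §3 the
unit quaternion `gnoUnit v = (1,v)/|(1,v)|` of the gnomonic point as a SMOOTH map `ℝ³ → ℍ` with the chart
factorisation `su2Quat(g · P(1,v)) = su2Quat g · gnoUnit v`; (iv) §4 the chart reading of a word insert about ANY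
reference `u₀`: a global smooth representative `chartWord` whose `k`-th block function is the profile
`−F_{Re c′, Im c′}` (`c′ = a · su2Quat(u₀ b_k)`, `‖c′‖ ≤ 1`, `T4GnomonicWilsonHessian.re_su2Quat_gnoChart_mul`), hence
`|∇|² ≤ m · (1 + ρ + ρ²)²` on `[−S,S]ⁿ` for `3S² ≤ ρ²` — this needs the links of the word to be DISTINCT
(`Function.Injective bd`); (v) §5 the PATH INSERT `pathInsert W` of a family of link words (`LinkWord s`: length, links,
orientations, cofactors) with `hBm`, `hR` (`R = 1`), `hBg` (`L = √M·(1+ρ+ρ²)` for words of length `≤ M`) discharged,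
and its consistency with `transverseInsert` (one-letter words); (vi) §6 the CENTRED INSERT `B − E^{W}_s[B | (u₀)_out]`
of an arbitrary insert `B`: it inherits `hBm`, `hR` (`2R`), `hBg` (same `L`: a constant shift) and has `MeanVanishes`
at `u₀` BY CONSTRUCTION (the conditional law at the reference is a probability measure under the printed proviso);
(vii) §7 the junction theorems BY NAME: `CondMeanSuppression` and the (CM) channel for CENTRED inserts about ANY
reference (`hsf₀` KEPT, NO `MeanVanishes` binder, NO oddness), their flat-reference instances with NO law-side
hypothesis, `MeanLipschitz` for path inserts, and the CLOSED flat-reference channel for centred path inserts; a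
two-link `example` (`Re(c₀ · U(b₁) · c₁ · U(b₂)* · c₂)`, `M = 2`).  WHY CENTRING AND NOT ODDNESS (honest): the global
symmetries of the windowed Wilson law about the flat field that are available on a plaquette-disjoint `s` (bondwise
inversion `y_b ↦ y_b⁻¹`, §6 of `T4WilsonResponseJunction`) flip the sign of `Re(L · p · R)` only when the complementary
cofactor is purely imaginary, which for `m ≥ 2` depends on the OTHER letters and fails generically; the centred insert
is the form in which a fluctuation term is actually consumed (`B − ⟨B⟩`), and its `MeanVanishes` datum is a theorem.
What REMAINS a binder after this module, honestly: the window numbers `0 < S < S′ ≤ 1`, `0 ≤ ρ ≤ 1/4`, `3·S′² ≤ ρ²`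
((USE-c)), the word data (`‖c_l‖ ≤ 1`, distinct links, length `≤ M`), the coefficient bound `A`, about a non-flat
reference the small field `hsf₀`, and — the substantive located item, untouched — that the live set of the consumer's
ACTUAL term lies inside `stapleLive s 1 0` UNIFORMLY in the step index (EST; for `k ≥ 1` the exponent is not the bare
Wilson action and nothing here applies verbatim).

CITATION HEADER.  Nothing of T. Bałaban's series (CMP 1984–89) is newly read, quoted or attributed in this module.  The
only contact with print is CONTEXT through tree headers quoted EARLIER and not re-quoted here (the Wilson action
`wilsonAction w` models [Balaban1987RG1] (0.2) p. 252, `Setup`; the term structure `condLaw` ∕ `condMean` ∕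
`linDensity` ∕ `fibreReading` ∕ `MeanVanishes` ∕ `MeanLipschitz` ∕ `CondMeanSuppression` is the cell's typed model of
one term of [Balaban1989LargeFieldI] (0.3), `B15BasicStep` ∕ `T4DressingDefect` ∕ `T4CondMeanChannel` ∕
`T4FirstOrderSize`).  ABSOLUTE RULE honoured: no programme-internal statement is an input; every declaration below is
[folklore] (associativity and submultiplicativity in `ℍ`, `Re(xy) = Re(yx)` in coordinates, the chain rule through an
affine block insertion, orthogonality of coordinate blocks, `‖su2Quat U‖ = 1`, continuity ⟹ measurability on the
second-countable group `SU(2)^m`, `∫ (B − ∫B dμ) dμ = 0` for a probability measure, specialisation of theorems already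
in the tree).

NEW vs PRINTED-TYPE.  PRINTED-TYPE: none newly used.  CELL MODEL typed EARLIER (by name): the junction theorems
`T4WilsonResponseJunction.meanLipschitz_wilson_disjoint` ∕ `condMeanSuppression_wilson_disjoint` ∕
`condMean_channel_wilson_disjoint` ∕ `smallField_flat` ∕ `wilsonGibbs_le` ∕ `fibreIntegral_wilsonGibbs_ne_zero`, the
conditional law `T4DressingDefect.condLaw` ∕ `isProbabilityMeasure_condLaw` ∕ `isZeroOrProbabilityMeasure_condLaw`,
the profile calculus `T4GnomonicWilsonHessian.gnoProfile` ∕ `sq_fderiv_gnoProfile_le` ∕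
`coordGradient_sq_le_of_sq_fderiv_le` ∕ `imVec` ∕ `re_su2Quat_gnoChart_mul` ∕ `norm_gnomonicQuat` ∕
`contDiff_dotProduct_self`, the block projection `T4WilsonDisjointLinks.blockProj` ∕ `sum_blockProj_dotProduct` ∕
`blockProj_mem_cube` ∕ `gnoFibreChart_eq_gnoChart_blockProj`, the quaternion bounds
`T4WilsonDatumBounds.re_sq_le_norm_sq`, `T4WilsonOddInsert.transverseInsert` ∕ `imVec_dotProduct_self_le_one` ∕
`abs_re_le_one`, the chart `T4CubeChartGnomonic.gnoPoint` ∕ `gnoChart` ∕ `gnoFibreChart` ∕ `bondCoordEquiv` ∕ `qI` ∕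
`qJ` ∕ `qK` ∕ `gnomonicQuat_eq_lincomb` ∕ `su2Quat_gnoPoint`, the quaternion model `QuantumLattice.su2Quat` ∕
`norm_su2Quat` ∕ `gnomonicQuat` ∕ `secondCountableTopology_su2` ∕ `T4HaarSU2Translate.continuous_su2Quat` ∕
`su2Quat_mul`.  NEW HERE (kernel, [folklore]): §1 quaternion words, §2 block insertion, §3 `gnoUnit`, §4 chart
words, §5 link words and the path insert, §6 centred inserts, §7 the specialised junction theorems and instances.

WHAT IS PROVED (all [folklore]; no `sorry`, no new axiom):
§1 `letter σ p` (`p` or `p*`), `norm_letter`, `re_letter`, `wordProd m σ c q` (structural recursion on `m`),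
   `wordProd_zero` ∕ `wordProd_succ`, `norm_wordProd_le` (`‖w‖ ≤ 1` for `‖c_l‖, ‖q_k‖ ≤ 1`), `wordProd_update` (SLOT
   STRUCTURE `w(q ← p at k) = L · p^{σ_k} · R`, `‖L‖, ‖R‖ ≤ 1`), `re_wordProd_update` (`Re w(q ← p at k) = Re(p · a)`,
   `‖a‖ ≤ 1`), `contDiff_letter`, `contDiff_fin_tail`, `contDiff_wordProd`, `contDiff_re_wordProd`,
   `measurable_re_wordProd_su2` (on `SU(2)^m`, product Borel structure).
§2 `blockIns e b x v` (`x ←_b v`), `blockIns_apply` ∕ `blockIns_apply_equiv`, `blockProj_blockIns_self` ∕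
   `blockProj_blockIns_of_ne` ∕ `blockIns_blockProj`, `blockEmb e b` (`ι_b`, a continuous linear map), `blockEmb_apply`,
   `blockIns_eq_add` (affine), `hasFDerivAt_blockIns` (`D_v(x ←_b v) = ι_b`), `blockEmb_single` (`ι_b e_i = e_{e(b,i)}`),
   `fderiv_comp_blockIns` (chain rule), `blockProj_coordGradient` (`π_b ∇g(x) = ∇_b g(x)`),
   `coordGradient_dotProduct_self_eq_sum` (`|∇g|² = Σ_b |∇_b g|²`), `coordGradient_sq_le_card_mul`
   (`|∇g(x)|² ≤ |T|·G²` for `g` constant in the blocks off `T` with block gradients `≤ G²` on `T`).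
§3 `gnoUnit`, `su2Quat_gnoPoint_eq_gnoUnit`, `su2Quat_gnoChart_eq` (`su2Quat(g · P(1,v)) = su2Quat g · gnoUnit v`),
   `norm_gnoUnit`, `contDiff_gnomonicQuat`, `contDiff_gnoUnit`.
§4 `chartWord e u₀ m σ c bd`, `chartWord_eq` (it IS the word insert along `gnoFibreChart s u₀ e`), `contDiff_chartWord`,
   `chartWord_blockIns_self` (inserting the block of `b_k` updates letter `k`; distinct links),
   `chartWord_blockIns_of_ne` (blocks off the word are silent), `block_coordGradient_chartWord_sq_le` (the `k`-th block
   function is `−F_{Re c′, Im c′}`, `|∇|² ≤ (1+ρ+ρ²)²` at `π_{b_k} x` for `x ∈ [−S,S]ⁿ`, `3S² ≤ ρ²`),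
   `chartRep_wordInsert` ((hBg) for words: `|∇|² ≤ m·(1+ρ+ρ²)²`).
§5 `LinkWord s` (structure: `len`, `bd`, `fwd`, `coef`), `pathInsert W`, `pathInsert_apply`, `measurable_pathInsert`
   (hBm), `abs_pathInsert_le` ∕ `norm_pathInsert_le` (hR, `R = 1`, cofactors of norm `≤ 1`), `oneLetter`,
   `pathInsert_oneLetter` (`= transverseInsert bd dir`), `chartRep_pathInsert` ((hBg), `L = √M·(1+ρ+ρ²)` for distinct
   links and length `≤ M`).
§6 `centredInsert s old u₀ B`, `centredInsert_apply`, `measurable_centredInsert`, `norm_integral_condLaw_le`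
   (`‖∫ f ∂condLaw‖ ≤ R` for `‖f‖ ≤ R`, zero-or-probability law), `norm_centredInsert_le` (`≤ 2R`),
   `chartRep_centredInsert` (same `L`), `meanVanishes_centredInsert` (`MeanVanishes` at `u₀` under the proviso
   `fibreIntegral s old u₀ ≠ 0`).
§7 `condMeanSuppression_wilson_centred` ∕ `condMean_channel_wilson_centred` ((J2c)∕(J3c) for centred inserts about a
   general `u₀`: binders `hε0`, `hsf₀` and the insert data of `B` KEPT, NO `MeanVanishes` binder; modulus
   `respSlope·(L/√respLam)`, suppression factor `1/8 − ε`), `condMean_channel_wilson_centred_flat` (about `u₀ = 1`,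
   `ε = 0`), `meanLipschitz_wilson_path` ∕ `meanLipschitz_wilson_path_flat` ((J1) for path inserts, modulus
   `respSlope·(√M(1+ρ+ρ²)/√respLam)`), `condMean_channel_wilson_path_centred` and the CLOSED
   `condMean_channel_wilson_path_centred_flat`: hypotheses `PlaqDisjoint s`, `0 < S < S′ ≤ 1`, `0 ≤ β`, `0 ≤ w`,
   `0 ≤ ρ ≤ 1/4`, `3S′² ≤ ρ²`, `∀ i ∈ T, (∀ l, ‖coef l‖ ≤ 1) ∧ bd injective ∧ len ≤ M`, `∀ i ∈ T, ‖a i‖ ≤ A` ONLY;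
   conclusion: for every `V` with `Σ_{b∈s} stapleDist b 1 V ≤ 1/8`,
   `|E^{W}_s[linDensity t T a (fibreReading s (pathInsert W − E^{W}_s[pathInsert W | 1_out])) | V_out]|
   ≤ |t|·(|T|·A·(respSlope·(√M(1+ρ+ρ²)/√respLam)·(1/8)))`, `W = χ_{s,1,S}·e^{−β A_w}`; the two-link `example`s and the
   non-vacuity `example`s.

HONEST SCOPE.  (a) `k = 0`, `G = SU(2)`, bare Wilson exponent, PLAQUETTE-DISJOINT `s`; about `u₀ ≠ 1` the small field
`hsf₀` stays a binder.  (b) The links of a word must be DISTINCT (a link variable occurring twice makes the block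
function quadratic and the slot structure fails); the cofactors are FIXED quaternions (the frozen links of the path are
part of the exterior and are NOT varied here — their dependence on the exterior `V` is the consumer's business).
(c) Centring replaces oddness: the closed statements concern `B − E^{W}_s[B | (u₀)_out]`, NOT `B`; the size of the
subtracted mean is NOT estimated here.  (d) The normalisation `‖c_l‖ ≤ 1` puts the size of the insert into the
coefficients `a i` (bound `A`); `Re tr` of an `SU(2)` path holonomy is such a word with unit-quaternion cofactors
(`T4GnomonicWilsonHessian.reTr_eq_re_su2Quat`, `su2Quat U⁻¹ = (su2Quat U)*`) — illustrated by the two-link `example`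
of §7, NOT developed into a general holonomy dictionary here.  (e) The
consumer's real live set is `liveSet s W′` of ITS term `W′`; that it sits inside `stapleLive s 1 0`, uniformly in `k`,
is the located estimate (EST) and is NOT claimed.  (f) Nothing printed is asserted; value = kernel certificate, NOT
summit progress.
-/

noncomputable section

open _root_.MeasureTheory
open scoped BigOperators Quaternion

namespace Literature.MathematicalPhysics.QuantumFieldTheory.Balaban1983to89.T4WilsonPathInsert

open B15.BasicStep T4DressingDefect T4FirstOrderSize
open Literature.MathematicalPhysics.QuantumLattice (su2Quat norm_su2Quat gnomonicQuat secondCountableTopology_su2)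
open Literature.Probability.Distributions (coordGradient)
open T4HaarSU2Translate (su2Quat_one continuous_su2Quat su2Quat_mul)
open T4WilsonLinkAffine (su2Quat_inv IsLetter)
open T4CubePoincare (cube mem_cube_iff)
open T4CubeChartGnomonic (SU2 gnoPoint gnoChart gnoFibreChart windowDensity bondCoordEquiv qI qJ qK
  gnomonicQuat_eq_lincomb su2Quat_gnoPoint)
open T4GnomonicWilsonHessian (gnoProfile imVec coordGradient_sq_le_of_sq_fderiv_le sq_fderiv_gnoProfile_le
  re_su2Quat_gnoChart_mul imVec_dotProduct_self one_add_dotProduct_self_pos contDiff_gnoProfile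
  contDiff_dotProduct_self dotProduct_self_le_of_mem_cube norm_gnomonicQuat reTr_eq_re_su2Quat)
open T4WilsonDatumBounds (re_sq_le_norm_sq abs_re_su2Quat_mul_le)
open T4WilsonDisjointLinks (PlaqDisjoint plaqDisjoint_singleton blockProj blockProj_apply sum_blockProj_dotProduct
  blockProj_mem_cube gnoFibreChart_eq_gnoChart_blockProj)
open T4WilsonStapleDeviation (stapleDist)
open T4CondMeanChannel (linDensity fibreReading)
open T4WilsonResponseJunction (respLam respSlope stapleLive meanLipschitz_wilson_disjoint
  condMeanSuppression_wilson_disjoint condMean_channel_wilson_disjoint smallField_flat wilsonGibbs_le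
  fibreIntegral_wilsonGibbs_ne_zero)
open T4WilsonOddInsert (transverseInsert transverseInsert_apply imVec_dotProduct_self_le_one abs_re_le_one)

/-! ## §1  Quaternion words -/

section Words

/-- THE LETTER of a link variable `p` in a word: `p` itself for a forward link (`σ = true`), the conjugate
`p* = star p` for a backward one. [folklore] -/
def letter (σ : Bool) (p : ℍ) : ℍ := bif σ then p else star p

/-- Forward letter. [folklore] -/
@[simp] theorem letter_true (p : ℍ) : letter true p = p := rfl

/-- Backward letter. [folklore] -/
@[simp] theorem letter_false (p : ℍ) : letter false p = star p := rfl

/-- `‖p^σ‖ = ‖p‖`. [folklore] -/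
theorem norm_letter (σ : Bool) (p : ℍ) : ‖letter σ p‖ = ‖p‖ := by
  cases σ
  · exact Quaternion.norm_star p
  · rfl

/-- `Re(p^σ) = Re p`. [folklore] -/
theorem re_letter (σ : Bool) (p : ℍ) : (letter σ p).re = p.re := by
  cases σ
  · exact Quaternion.re_star p
  · rfl

/-- **THE WORD** `w(σ, c; q) = c₀ · q₀^{σ₀} · c₁ · q₁^{σ₁} ⋯ q_{m-1}^{σ_{m-1}} · c_m` of `m` letters `q_k ∈ ℍ` with
orientations `σ_k` and `m + 1` fixed cofactors `c_l ∈ ℍ` (structural recursion on `m`). [folklore] -/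
def wordProd : (m : ℕ) → (Fin m → Bool) → (Fin (m + 1) → ℍ) → (Fin m → ℍ) → ℍ
  | 0, _, c, _ => c 0
  | m + 1, σ, c, q => c 0 * letter (σ 0) (q 0) * wordProd m (Fin.tail σ) (Fin.tail c) (Fin.tail q)

/-- The empty word is its cofactor. [folklore] -/
@[simp] theorem wordProd_zero (σ : Fin 0 → Bool) (c : Fin 1 → ℍ) (q : Fin 0 → ℍ) : wordProd 0 σ c q = c 0 := rfl

/-- Unfolding the first letter. [folklore] -/
theorem wordProd_succ {m : ℕ} (σ : Fin (m + 1) → Bool) (c : Fin (m + 2) → ℍ) (q : Fin (m + 1) → ℍ) :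
    wordProd (m + 1) σ c q = c 0 * letter (σ 0) (q 0) * wordProd m (Fin.tail σ) (Fin.tail c) (Fin.tail q) := rfl

/-- **SUBMULTIPLICATIVITY**: `‖w‖ ≤ 1` when all cofactors and letters have norm `≤ 1`. [folklore] -/
theorem norm_wordProd_le {m : ℕ} {σ : Fin m → Bool} {c : Fin (m + 1) → ℍ} {q : Fin m → ℍ}
    (hc : ∀ l, ‖c l‖ ≤ 1) (hq : ∀ k, ‖q k‖ ≤ 1) : ‖wordProd m σ c q‖ ≤ 1 := by
  induction m with
  | zero => exact hc 0
  | succ m ih =>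
    rw [wordProd_succ, norm_mul, norm_mul, norm_letter]
    have h1 : ‖wordProd m (Fin.tail σ) (Fin.tail c) (Fin.tail q)‖ ≤ 1 :=
      ih (fun l => hc l.succ) (fun k => hq k.succ)
    calc ‖c 0‖ * ‖q 0‖ * ‖wordProd m (Fin.tail σ) (Fin.tail c) (Fin.tail q)‖ ≤ 1 * 1 * 1 :=
        mul_le_mul (mul_le_mul (hc 0) (hq 0) (norm_nonneg _) zero_le_one) h1 (norm_nonneg _) (by norm_num)
      _ = 1 := by norm_num

/-- **THE SLOT STRUCTURE**: as a function of its `k`-th letter the word is `p ↦ L · p^{σ_k} · R` with `‖L‖, ‖R‖ ≤ 1`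
(`L`, `R` the partial words to the left and right of the slot). [folklore] -/
theorem wordProd_update {m : ℕ} (σ : Fin m → Bool) {c : Fin (m + 1) → ℍ} {q : Fin m → ℍ}
    (hc : ∀ l, ‖c l‖ ≤ 1) (hq : ∀ k, ‖q k‖ ≤ 1) (k : Fin m) :
    ∃ L R : ℍ, ‖L‖ ≤ 1 ∧ ‖R‖ ≤ 1 ∧ ∀ p, wordProd m σ c (Function.update q k p) = L * letter (σ k) p * R := by
  induction m with
  | zero => exact k.elim0
  | succ m ih =>
    rcases Fin.eq_zero_or_eq_succ k with rfl | ⟨i, rfl⟩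
    · refine ⟨c 0, wordProd m (Fin.tail σ) (Fin.tail c) (Fin.tail q), hc 0,
        norm_wordProd_le (fun l => hc l.succ) (fun k => hq k.succ), fun p => ?_⟩
      rw [wordProd_succ, Function.update_self, Fin.tail_update_zero]
    · obtain ⟨L, R, hL, hR, h⟩ :=
        ih (Fin.tail σ) (c := Fin.tail c) (q := Fin.tail q) (fun l => hc l.succ) (fun k => hq k.succ) i
      refine ⟨c 0 * letter (σ 0) (q 0) * L, R, ?_, hR, fun p => ?_⟩
      · rw [norm_mul, norm_mul, norm_letter]
        calc ‖c 0‖ * ‖q 0‖ * ‖L‖ ≤ 1 * 1 * 1 :=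
            mul_le_mul (mul_le_mul (hc 0) (hq 0) (norm_nonneg _) zero_le_one) hL (norm_nonneg _) (by norm_num)
          _ = 1 := by norm_num
      · rw [wordProd_succ, Function.update_of_ne (Fin.succ_ne_zero i).symm, Fin.tail_update_succ, h]
        simp only [Fin.tail, mul_assoc]

/-- **THE REAL PART IN ONE SLOT**: `Re w(q ← p at k) = Re(p · a)` with `‖a‖ ≤ 1` INDEPENDENT of `p`
(`Re(L p R) = Re(p · R L)`, `Re(L p* R) = Re(p · (R L)*)`). [folklore] -/
theorem re_wordProd_update {m : ℕ} (σ : Fin m → Bool) {c : Fin (m + 1) → ℍ} {q : Fin m → ℍ}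
    (hc : ∀ l, ‖c l‖ ≤ 1) (hq : ∀ k, ‖q k‖ ≤ 1) (k : Fin m) :
    ∃ a : ℍ, ‖a‖ ≤ 1 ∧ ∀ p, (wordProd m σ c (Function.update q k p)).re = (p * a).re := by
  obtain ⟨L, R, hL, hR, h⟩ := wordProd_update σ hc hq k
  have hRL : ‖R * L‖ ≤ 1 := by
    rw [norm_mul]
    exact mul_le_one₀ hR (norm_nonneg _) hL
  cases hσ : σ k
  · refine ⟨star (R * L), by rwa [Quaternion.norm_star], fun p => ?_⟩
    rw [h p, hσ, letter_false]
    simp only [Quaternion.re_mul, Quaternion.imI_mul, Quaternion.imJ_mul, Quaternion.imK_mul, Quaternion.re_star,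
      Quaternion.imI_star, Quaternion.imJ_star, Quaternion.imK_star]
    ring
  · refine ⟨R * L, hRL, fun p => ?_⟩
    rw [h p, hσ, letter_true]
    simp only [Quaternion.re_mul, Quaternion.imI_mul, Quaternion.imJ_mul, Quaternion.imK_mul]
    ring

/-- The letter map is smooth (`p* = 2 Re p − p` is real-linear). [folklore] -/
theorem contDiff_letter (σ : Bool) {n : WithTop ℕ∞} : ContDiff ℝ n (letter σ) := by
  cases σ
  · have hre : ContDiff ℝ n fun q : ℍ => q.re :=
      (EuclideanSpace.proj (0 : Fin 4)).contDiff.comp Quaternion.linearIsometryEquivTuple.contDiff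
    have h : (letter false : ℍ → ℍ) = fun q : ℍ => (2 * q.re) • (1 : ℍ) - q := by
      funext q
      rw [letter_false, Quaternion.star_eq_two_re_sub, ← Quaternion.coe_mul_eq_smul, mul_one]
    rw [h]
    exact ((contDiff_const.mul hre).smul contDiff_const).sub contDiff_id
  · exact contDiff_id

/-- `Fin.tail` is smooth (linear). [folklore] -/
theorem contDiff_fin_tail {m : ℕ} {n : WithTop ℕ∞} : ContDiff ℝ n (Fin.tail : (Fin (m + 1) → ℍ) → Fin m → ℍ) :=
  contDiff_pi.2 fun i => contDiff_apply ℝ ℍ i.succ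

/-- **The word is a smooth function of its letters** (a polynomial map). [folklore] -/
theorem contDiff_wordProd {n : WithTop ℕ∞} {m : ℕ} (σ : Fin m → Bool) (c : Fin (m + 1) → ℍ) :
    ContDiff ℝ n (wordProd m σ c) := by
  induction m with
  | zero => exact contDiff_const
  | succ m ih =>
    rw [show wordProd (m + 1) σ c
      = fun q => c 0 * letter (σ 0) (q 0) * wordProd m (Fin.tail σ) (Fin.tail c) (Fin.tail q) from rfl]
    exact (contDiff_const.mul ((contDiff_letter (σ 0)).comp (contDiff_apply ℝ ℍ 0))).mul
      ((ih (Fin.tail σ) (Fin.tail c)).comp contDiff_fin_tail)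

/-- … and so is its real part. [folklore] -/
theorem contDiff_re_wordProd {n : WithTop ℕ∞} (m : ℕ) (σ : Fin m → Bool) (c : Fin (m + 1) → ℍ) :
    ContDiff ℝ n fun q => (wordProd m σ c q).re :=
  ((EuclideanSpace.proj (0 : Fin 4)).contDiff.comp Quaternion.linearIsometryEquivTuple.contDiff).comp
    (contDiff_wordProd σ c)

/-- **MEASURABILITY ON `SU(2)^m`**: the real part of a word in the unit quaternions of `m` group elements is a
measurable (continuous) function on `SU(2)^m` (product Borel structure; `SU(2)` is second countable). [folklore] -/
theorem measurable_re_wordProd_su2 {m : ℕ} (σ : Fin m → Bool) (c : Fin (m + 1) → ℍ) :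
    Measurable fun Y : Fin m → SU2 => (wordProd m σ c fun k => su2Quat (Y k)).re := by
  haveI : SecondCountableTopology SU2 := secondCountableTopology_su2
  exact ((contDiff_re_wordProd (n := 0) m σ c).continuous.comp
    (continuous_pi fun k => continuous_su2Quat.comp (continuous_apply k))).measurable

end Words

/-! ## §2  Block insertion on `ℝⁿ = ⊕_b ℝᵐ` -/

section Blocks

variable {κ : Type*} [DecidableEq κ] {m n : ℕ}

/-- **BLOCK INSERTION**: replace the block `b` of `x ∈ ℝⁿ` by `v ∈ ℝᵐ` (`x_{e(b,i)} ← v_i`). [folklore] -/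
def blockIns (e : κ × Fin m ≃ Fin n) (b : κ) (x : Fin n → ℝ) (v : Fin m → ℝ) : Fin n → ℝ :=
  fun l => if (e.symm l).1 = b then v (e.symm l).2 else x l

/-- Unfolding lemma. [folklore] -/
theorem blockIns_apply (e : κ × Fin m ≃ Fin n) (b : κ) (x : Fin n → ℝ) (v : Fin m → ℝ) (l : Fin n) :
    blockIns e b x v l = if (e.symm l).1 = b then v (e.symm l).2 else x l := rfl

/-- The coordinates of an inserted block. [folklore] -/
theorem blockIns_apply_equiv (e : κ × Fin m ≃ Fin n) (b b' : κ) (x : Fin n → ℝ) (v : Fin m → ℝ) (i : Fin m) :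
    blockIns e b x v (e (b', i)) = if b' = b then v i else x (e (b', i)) := by
  simp [blockIns, Equiv.symm_apply_apply]

/-- `π_b (x ←_b v) = v`. [folklore] -/
@[simp] theorem blockProj_blockIns_self (e : κ × Fin m ≃ Fin n) (b : κ) (x : Fin n → ℝ) (v : Fin m → ℝ) :
    blockProj e b (blockIns e b x v) = v := by
  ext i
  rw [blockProj_apply, blockIns_apply_equiv, if_pos rfl]

/-- `π_{b'} (x ←_b v) = π_{b'} x` for `b' ≠ b`. [folklore] -/
theorem blockProj_blockIns_of_ne (e : κ × Fin m ≃ Fin n) {b b' : κ} (h : b' ≠ b) (x : Fin n → ℝ) (v : Fin m → ℝ) :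
    blockProj e b' (blockIns e b x v) = blockProj e b' x := by
  ext i
  rw [blockProj_apply, blockProj_apply, blockIns_apply_equiv, if_neg h]

/-- `x ←_b (π_b x) = x`. [folklore] -/
theorem blockIns_blockProj (e : κ × Fin m ≃ Fin n) (b : κ) (x : Fin n → ℝ) :
    blockIns e b x (blockProj e b x) = x := by
  ext l
  rw [blockIns_apply]
  split_ifs with h
  · rw [blockProj_apply, ← h, Prod.mk.eta, Equiv.apply_symm_apply]
  · rfl

/-- THE BLOCK EMBEDDING `ι_b : ℝᵐ → ℝⁿ` (the linear part of `v ↦ x ←_b v`). [folklore] -/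
def blockEmb (e : κ × Fin m ≃ Fin n) (b : κ) : (Fin m → ℝ) →L[ℝ] (Fin n → ℝ) :=
  ContinuousLinearMap.pi fun l => if (e.symm l).1 = b then ContinuousLinearMap.proj (e.symm l).2 else 0

/-- Unfolding lemma. [folklore] -/
theorem blockEmb_apply (e : κ × Fin m ≃ Fin n) (b : κ) (v : Fin m → ℝ) (l : Fin n) :
    blockEmb e b v l = if (e.symm l).1 = b then v (e.symm l).2 else 0 := by
  simp only [blockEmb, ContinuousLinearMap.pi_apply]
  split_ifs <;> rfl

/-- `x ←_b v = (x ←_b 0) + ι_b v`: block insertion is affine in `v`. [folklore] -/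
theorem blockIns_eq_add (e : κ × Fin m ≃ Fin n) (b : κ) (x : Fin n → ℝ) (v : Fin m → ℝ) :
    blockIns e b x v = blockIns e b x 0 + blockEmb e b v := by
  ext l
  rw [Pi.add_apply, blockIns_apply, blockIns_apply, blockEmb_apply]
  split_ifs <;> simp

/-- `D_v (x ←_b v) = ι_b`. [folklore] -/
theorem hasFDerivAt_blockIns (e : κ × Fin m ≃ Fin n) (b : κ) (x : Fin n → ℝ) (v : Fin m → ℝ) :
    HasFDerivAt (blockIns e b x) (blockEmb e b) v := by
  rw [show blockIns e b x = fun v => blockIns e b x 0 + blockEmb e b v from funext (blockIns_eq_add e b x)]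
  exact ((blockEmb e b).hasFDerivAt).const_add _

/-- `ι_b e_i = e_{e(b,i)}`. [folklore] -/
theorem blockEmb_single (e : κ × Fin m ≃ Fin n) (b : κ) (i : Fin m) :
    blockEmb e b (Pi.single i 1) = Pi.single (e (b, i)) 1 := by
  ext l
  obtain ⟨⟨b', i'⟩, rfl⟩ := e.surjective l
  rw [blockEmb_apply, Equiv.symm_apply_apply]
  by_cases hb : b' = b
  · subst hb
    by_cases hi : i' = i
    · subst hi
      simp
    · rw [if_pos rfl, Pi.single_eq_of_ne hi, Pi.single_eq_of_ne]
      exact fun h => hi (Prod.ext_iff.1 (e.injective h)).2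
  · rw [if_neg hb, Pi.single_eq_of_ne]
    exact fun h => hb (Prod.ext_iff.1 (e.injective h)).1

/-- **CHAIN RULE THROUGH A BLOCK**: `D_v g(x ←_b v)|_{v = π_b x} u = Dg(x)(ι_b u)`. [folklore] -/
theorem fderiv_comp_blockIns {g : (Fin n → ℝ) → ℝ} {x : Fin n → ℝ} (hg : DifferentiableAt ℝ g x)
    (e : κ × Fin m ≃ Fin n) (b : κ) (u : Fin m → ℝ) :
    fderiv ℝ (fun v => g (blockIns e b x v)) (blockProj e b x) u = fderiv ℝ g x (blockEmb e b u) := by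
  have hx : blockIns e b x (blockProj e b x) = x := blockIns_blockProj e b x
  have hg' : DifferentiableAt ℝ g (blockIns e b x (blockProj e b x)) := by
    rw [hx]
    exact hg
  rw [show (fun v => g (blockIns e b x v)) = g ∘ blockIns e b x from rfl,
    fderiv_comp _ hg' (hasFDerivAt_blockIns e b x _).differentiableAt, (hasFDerivAt_blockIns e b x _).fderiv,
    ContinuousLinearMap.comp_apply, hx]

/-- **THE BLOCKS OF THE GRADIENT** are the gradients of the block functions: `π_b ∇g(x) = ∇_v g(x ←_b v)|_{π_b x}`.
[folklore] -/
theorem blockProj_coordGradient {g : (Fin n → ℝ) → ℝ} {x : Fin n → ℝ} (hg : DifferentiableAt ℝ g x)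
    (e : κ × Fin m ≃ Fin n) (b : κ) :
    blockProj e b (coordGradient g x) = coordGradient (fun v => g (blockIns e b x v)) (blockProj e b x) := by
  ext i
  simp only [blockProj_apply, coordGradient]
  rw [fderiv_comp_blockIns hg, blockEmb_single]

/-- **`|∇g(x)|² = Σ_b |∇_b g(x)|²`** (the blocks are orthogonal and exhaust `ℝⁿ`). [folklore] -/
theorem coordGradient_dotProduct_self_eq_sum [Fintype κ] (e : κ × Fin m ≃ Fin n) {g : (Fin n → ℝ) → ℝ}
    {x : Fin n → ℝ} (hg : DifferentiableAt ℝ g x) :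
    coordGradient g x ⬝ᵥ coordGradient g x
      = ∑ b, coordGradient (fun v => g (blockIns e b x v)) (blockProj e b x)
          ⬝ᵥ coordGradient (fun v => g (blockIns e b x v)) (blockProj e b x) := by
  rw [← sum_blockProj_dotProduct e (coordGradient g x) (coordGradient g x)]
  simp only [blockProj_coordGradient hg]

/-- **THE GRADIENT OF A FUNCTION OF FEW BLOCKS**: if `g` does not depend on the blocks outside `T` and each block
gradient at `x` has `|∇_b g|² ≤ G²` on `T`, then `|∇g(x)|² ≤ |T| · G²`. [folklore] -/
theorem coordGradient_sq_le_card_mul [Fintype κ] (e : κ × Fin m ≃ Fin n) {g : (Fin n → ℝ) → ℝ} {x : Fin n → ℝ}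
    (hg : DifferentiableAt ℝ g x) (T : Finset κ) (hoff : ∀ b ∉ T, ∀ v, g (blockIns e b x v) = g x) {G : ℝ}
    (hG : ∀ b ∈ T, coordGradient (fun v => g (blockIns e b x v)) (blockProj e b x)
      ⬝ᵥ coordGradient (fun v => g (blockIns e b x v)) (blockProj e b x) ≤ G ^ 2) :
    coordGradient g x ⬝ᵥ coordGradient g x ≤ T.card * G ^ 2 := by
  rw [coordGradient_dotProduct_self_eq_sum e hg]
  have hzero : ∀ b ∈ (Finset.univ : Finset κ), b ∉ T →
      coordGradient (fun v => g (blockIns e b x v)) (blockProj e b x)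
        ⬝ᵥ coordGradient (fun v => g (blockIns e b x v)) (blockProj e b x) = 0 := by
    intro b _ hb
    have h : (fun v => g (blockIns e b x v)) = fun _ => g x := funext (hoff b hb)
    rw [h]
    have h0 : coordGradient (fun _ : Fin m → ℝ => g x) (blockProj e b x) = 0 := by
      funext i
      simp only [coordGradient, Pi.zero_apply]
      rw [fderiv_const_apply]
      rfl
    rw [h0, dotProduct_zero]
  rw [← Finset.sum_subset (Finset.subset_univ T) hzero]
  calc ∑ b ∈ T, coordGradient (fun v => g (blockIns e b x v)) (blockProj e b x)
          ⬝ᵥ coordGradient (fun v => g (blockIns e b x v)) (blockProj e b x)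
        ≤ ∑ b ∈ T, G ^ 2 := Finset.sum_le_sum hG
    _ = T.card * G ^ 2 := by rw [Finset.sum_const, nsmul_eq_mul]

end Blocks

/-! ## §3  The unit quaternion of the gnomonic point as a smooth map `ℝ³ → ℍ` -/

section Unit

/-- **THE GNOMONIC UNIT** `(1,v)/|(1,v)| ∈ ℍ` as a function of `v ∈ ℝ³` (`= su2Quat (gnoPoint v)`). [folklore] -/
def gnoUnit (v : Fin 3 → ℝ) : ℍ := (Real.sqrt (1 + v ⬝ᵥ v))⁻¹ • gnomonicQuat v

/-- `su2Quat (P(1,v)) = gnoUnit v`. [folklore] -/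
theorem su2Quat_gnoPoint_eq_gnoUnit (v : Fin 3 → ℝ) : su2Quat (gnoPoint v) = gnoUnit v := by
  rw [su2Quat_gnoPoint, norm_gnomonicQuat]
  rfl

/-- **THE CHART FACTORISATION**: `su2Quat (g · P(1,v)) = su2Quat g · gnoUnit v`. [folklore] -/
theorem su2Quat_gnoChart_eq (g : SU2) (v : Fin 3 → ℝ) : su2Quat (gnoChart g v) = su2Quat g * gnoUnit v := by
  rw [gnoChart, su2Quat_mul, su2Quat_gnoPoint_eq_gnoUnit]

/-- `‖gnoUnit v‖ = 1`. [folklore] -/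
theorem norm_gnoUnit (v : Fin 3 → ℝ) : ‖gnoUnit v‖ = 1 := by
  rw [← su2Quat_gnoPoint_eq_gnoUnit]
  exact norm_su2Quat _

/-- `v ↦ (1, v)` is smooth (affine). [folklore] -/
theorem contDiff_gnomonicQuat {k : WithTop ℕ∞} : ContDiff ℝ k gnomonicQuat := by
  rw [show gnomonicQuat = fun v => 1 + v 0 • qI + v 1 • qJ + v 2 • qK from funext gnomonicQuat_eq_lincomb]
  exact ((contDiff_const.add ((contDiff_apply ℝ ℝ 0).smul contDiff_const)).add
    ((contDiff_apply ℝ ℝ 1).smul contDiff_const)).add ((contDiff_apply ℝ ℝ 2).smul contDiff_const)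

/-- **`gnoUnit` is smooth** (`1 + v·v ≥ 1`). [folklore] -/
theorem contDiff_gnoUnit {k : WithTop ℕ∞} : ContDiff ℝ k gnoUnit := by
  unfold gnoUnit
  refine ContDiff.smul (ContDiff.inv ?_ fun v => (Real.sqrt_pos.2 (one_add_dotProduct_self_pos v)).ne')
    contDiff_gnomonicQuat
  exact (contDiff_const.add contDiff_dotProduct_self).sqrt fun v => (one_add_dotProduct_self_pos v).ne'

end Unit

/-! ## §4  Words read in the gnomonic fibre chart -/

section Chart

variable {P : Params} {j : ℕ} [DecidableEq (PBond P j)] {s : Finset (PBond P j)} {n : ℕ} {u₀ : GaugeField P j SU2}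

/-- **THE CHART WORD**: `x ↦ Re w(σ, c; (su2Quat(u₀ b_k) · gnoUnit(π_{b_k} x))_k)` — the global smooth representative
of the word insert read in the gnomonic fibre chart about `u₀`. [folklore] -/
def chartWord (e : ↥s × Fin 3 ≃ Fin n) (u₀ : GaugeField P j SU2) (m : ℕ) (σ : Fin m → Bool) (c : Fin (m + 1) → ℍ)
    (bd : Fin m → ↥s) (x : Fin n → ℝ) : ℝ :=
  (wordProd m σ c fun k => su2Quat (u₀ (bd k)) * gnoUnit (blockProj e (bd k) x)).re

omit [DecidableEq (PBond P j)] in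
/-- The chart word IS the word insert along the fibre chart (everywhere, not only on the cube). [folklore] -/
theorem chartWord_eq (e : ↥s × Fin 3 ≃ Fin n) (m : ℕ) (σ : Fin m → Bool) (c : Fin (m + 1) → ℍ) (bd : Fin m → ↥s)
    (x : Fin n → ℝ) :
    chartWord e u₀ m σ c bd x = (wordProd m σ c fun k => su2Quat (gnoFibreChart s u₀ e x (bd k))).re := by
  simp only [chartWord, gnoFibreChart_eq_gnoChart_blockProj, su2Quat_gnoChart_eq]

omit [DecidableEq (PBond P j)] in
/-- The chart word is smooth. [folklore] -/
theorem contDiff_chartWord (e : ↥s × Fin 3 ≃ Fin n) (m : ℕ) (σ : Fin m → Bool) (c : Fin (m + 1) → ℍ)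
    (bd : Fin m → ↥s) {k : WithTop ℕ∞} : ContDiff ℝ k (chartWord e u₀ m σ c bd) :=
  (contDiff_re_wordProd m σ c).comp
    (contDiff_pi.2 fun k => contDiff_const.mul (contDiff_gnoUnit.comp (blockProj e (bd k)).contDiff))

/-- Inserting the block of the `k`-th link updates the `k`-th letter (the links of the word are DISTINCT). [folklore] -/
theorem chartWord_blockIns_self (e : ↥s × Fin 3 ≃ Fin n) (m : ℕ) (σ : Fin m → Bool) (c : Fin (m + 1) → ℍ)
    {bd : Fin m → ↥s} (hbd : Function.Injective bd) (k : Fin m) (x : Fin n → ℝ) (v : Fin 3 → ℝ) :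
    chartWord e u₀ m σ c bd (blockIns e (bd k) x v)
      = (wordProd m σ c (Function.update (fun l => su2Quat (u₀ (bd l)) * gnoUnit (blockProj e (bd l) x)) k
          (su2Quat (u₀ (bd k)) * gnoUnit v))).re := by
  unfold chartWord
  congr 2
  funext l
  by_cases hl : l = k
  · subst hl
    rw [Function.update_self, blockProj_blockIns_self]
  · rw [Function.update_of_ne hl, blockProj_blockIns_of_ne e (fun h => hl (hbd h))]

/-- Inserting a block off the word does nothing. [folklore] -/
theorem chartWord_blockIns_of_ne (e : ↥s × Fin 3 ≃ Fin n) (m : ℕ) (σ : Fin m → Bool) (c : Fin (m + 1) → ℍ)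
    {bd : Fin m → ↥s} {b : ↥s} (hb : ∀ k, bd k ≠ b) (x : Fin n → ℝ) (v : Fin 3 → ℝ) :
    chartWord e u₀ m σ c bd (blockIns e b x v) = chartWord e u₀ m σ c bd x := by
  unfold chartWord
  congr 2
  funext l
  rw [blockProj_blockIns_of_ne e (hb l)]

/-- **THE BLOCK GRADIENT OF THE CHART WORD**: for cofactors of norm `≤ 1`, `0 ≤ ρ`, `3S² ≤ ρ²` and `x ∈ [−S,S]ⁿ`,
the block function of the `k`-th link is `v ↦ Re(su2Quat(u₀ b_k · P(1,v)) · a) = −F_{Re c', Im c'}(v)`, `c' = a · su2Quat(u₀ b_k)`,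
`‖c'‖ ≤ 1`, whose gradient at `π_{b_k} x` has `|∇|² ≤ (1 + ρ + ρ²)²` (`sq_fderiv_gnoProfile_le`). [folklore] -/
theorem block_coordGradient_chartWord_sq_le (e : ↥s × Fin 3 ≃ Fin n) {m : ℕ} (σ : Fin m → Bool) {c : Fin (m + 1) → ℍ}
    (hc : ∀ l, ‖c l‖ ≤ 1) {bd : Fin m → ↥s} (hbd : Function.Injective bd) {S ρ : ℝ} (hρ : 0 ≤ ρ)
    (h3S : 3 * S ^ 2 ≤ ρ ^ 2) {x : Fin n → ℝ} (hx : x ∈ cube n S) (k : Fin m) :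
    coordGradient (fun v => chartWord e u₀ m σ c bd (blockIns e (bd k) x v)) (blockProj e (bd k) x)
      ⬝ᵥ coordGradient (fun v => chartWord e u₀ m σ c bd (blockIns e (bd k) x v)) (blockProj e (bd k) x)
        ≤ (1 + ρ + ρ ^ 2) ^ 2 := by
  have hQ1 : ∀ l, ‖(fun l => su2Quat (u₀ (bd l)) * gnoUnit (blockProj e (bd l) x)) l‖ ≤ 1 := fun l => by
    simp only
    rw [norm_mul, norm_su2Quat, norm_gnoUnit, mul_one]
  obtain ⟨a, ha, hslot⟩ := re_wordProd_update σ hc hQ1 k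
  set c' : ℍ := a * su2Quat (u₀ (bd k)) with hc'
  have hfun : (fun v => chartWord e u₀ m σ c bd (blockIns e (bd k) x v))
      = fun v => -gnoProfile c'.re (imVec c') v := by
    funext v
    rw [chartWord_blockIns_self e m σ c hbd, hslot, ← su2Quat_gnoChart_eq, re_su2Quat_gnoChart_mul]
  rw [hfun]
  have hc1 : ‖c'‖ ≤ 1 := by
    rw [hc', norm_mul, norm_su2Quat, mul_one]
    exact ha
  have hB : imVec c' ⬝ᵥ imVec c' ≤ 1 ^ 2 := imVec_dotProduct_self_le_one hc1
  have hA : |c'.re| ≤ 1 := abs_re_le_one hc1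
  have hxb : blockProj e (bd k) x ⬝ᵥ blockProj e (bd k) x ≤ ρ ^ 2 := by
    have h := dotProduct_self_le_of_mem_cube (blockProj_mem_cube e (bd k) hx)
    have h3 : ((3 : ℕ) : ℝ) * S ^ 2 = 3 * S ^ 2 := by norm_num
    linarith
  refine coordGradient_sq_le_of_sq_fderiv_le fun w => ?_
  have hneg : fderiv ℝ (fun v => -gnoProfile c'.re (imVec c') v) (blockProj e (bd k) x) w
      = -(fderiv ℝ (gnoProfile c'.re (imVec c')) (blockProj e (bd k) x) w) := by
    rw [fderiv_fun_neg]
    rfl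
  rw [hneg, neg_sq]
  refine (sq_fderiv_gnoProfile_le zero_le_one hB hρ hxb w).trans (mul_le_mul_of_nonneg_right ?_ ?_)
  · have h0 : 0 ≤ 1 * (1 + ρ ^ 2) + |c'.re| * ρ := by positivity
    have hle : 1 * (1 + ρ ^ 2) + |c'.re| * ρ ≤ 1 + ρ + ρ ^ 2 := by nlinarith [abs_nonneg c'.re]
    exact pow_le_pow_left₀ h0 hle 2
  · simpa using dotProduct_star_self_nonneg w

/-- **(hBg) FOR WORD INSERTS, ABOUT ANY REFERENCE**: for cofactors of norm `≤ 1`, DISTINCT links, `0 ≤ ρ` and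
`3S² ≤ ρ²`, the chart reading `x ↦ Re w(σ, c; (su2Quat(Φ(x)_{b_k}))_k)` on `[−S,S]ⁿ` has the global `C¹` representative
`chartWord` with `|∇|² ≤ m · (1 + ρ + ρ²)²` (`m` blocks, each `(1 + ρ + ρ²)`-Lipschitz; blocks off the word silent).
[folklore] -/
theorem chartRep_wordInsert (e : ↥s × Fin 3 ≃ Fin n) {m : ℕ} (σ : Fin m → Bool) {c : Fin (m + 1) → ℍ}
    (hc : ∀ l, ‖c l‖ ≤ 1) {bd : Fin m → ↥s} (hbd : Function.Injective bd) {S ρ : ℝ} (hρ : 0 ≤ ρ)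
    (h3S : 3 * S ^ 2 ≤ ρ ^ 2) :
    ∃ g : (Fin n → ℝ) → ℝ, ContDiff ℝ 1 g ∧
      (∀ x ∈ cube n S, g x = (wordProd m σ c fun k => su2Quat (gnoFibreChart s u₀ e x (bd k))).re) ∧
      ∀ x ∈ cube n S, coordGradient g x ⬝ᵥ coordGradient g x ≤ m * (1 + ρ + ρ ^ 2) ^ 2 := by
  refine ⟨chartWord e u₀ m σ c bd, contDiff_chartWord e m σ c bd, fun x _ => chartWord_eq e m σ c bd x,
    fun x hx => ?_⟩
  have hdiff : DifferentiableAt ℝ (chartWord e u₀ m σ c bd) x :=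
    ((contDiff_chartWord e m σ c bd (k := 1)).differentiable one_ne_zero).differentiableAt
  have h := coordGradient_sq_le_card_mul e hdiff (Finset.univ.image bd)
    (fun b hb v => chartWord_blockIns_of_ne e m σ c
      (fun k hk => hb (Finset.mem_image.2 ⟨k, Finset.mem_univ k, hk⟩)) x v)
    (G := 1 + ρ + ρ ^ 2) (fun b hb => by
      obtain ⟨k, -, rfl⟩ := Finset.mem_image.1 hb
      exact block_coordGradient_chartWord_sq_le e σ hc hbd hρ h3S hx k)
  rwa [Finset.card_image_of_injective _ hbd, Finset.card_univ, Fintype.card_fin] at h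

end Chart

/-! ## §5  The path insert of a family of link words -/

section Path

variable {P : Params} {j : ℕ} {s : Finset (PBond P j)} {ι : Type*}

/-- **A LINK WORD** on the patch `s`: `len` letters reading the links `bd k ∈ s` with orientations `fwd k`
(`true` = the link variable, `false` = its conjugate = the reversed link), and `len + 1` fixed quaternion cofactors
`coef l` (the frozen links of a lattice path between the variable ones, already multiplied out). [folklore] -/
structure LinkWord (s : Finset (PBond P j)) where
  /-- number of variable letters -/
  len : ℕ
  /-- the links read by the letters -/
  bd : Fin len → ↥s
  /-- orientations of the letters -/
  fwd : Fin len → Bool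
  /-- the fixed cofactors between the letters -/
  coef : Fin (len + 1) → ℍ

/-- **THE PATH INSERT** of a family of link words: index `i` reads `y ↦ Re w_i((su2Quat (y (bd_i k)))_k)`. [folklore] -/
def pathInsert (W : ι → LinkWord s) : (↥s → SU2) → ι → ℝ :=
  fun y i => (wordProd (W i).len (W i).fwd (W i).coef fun k => su2Quat (y ((W i).bd k))).re

/-- Unfolding lemma. [folklore] -/
theorem pathInsert_apply (W : ι → LinkWord s) (y : ↥s → SU2) (i : ι) :
    pathInsert W y i = (wordProd (W i).len (W i).fwd (W i).coef fun k => su2Quat (y ((W i).bd k))).re := rfl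

/-- **(hBm)** the path insert is measurable in the fibre variable. [folklore] -/
theorem measurable_pathInsert (W : ι → LinkWord s) (i : ι) : Measurable fun y : ↥s → SU2 => pathInsert W y i :=
  (measurable_re_wordProd_su2 (W i).fwd (W i).coef).comp (measurable_pi_lambda _ fun _ => measurable_pi_apply _)

/-- **(hR)** `|pathInsert W y i| ≤ 1` for cofactors of norm `≤ 1` (the letters are unit quaternions). [folklore] -/
theorem abs_pathInsert_le (W : ι → LinkWord s) {i : ι} (hW : ∀ l, ‖(W i).coef l‖ ≤ 1) (y : ↥s → SU2) :
    |pathInsert W y i| ≤ 1 := by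
  rw [pathInsert_apply]
  have h1 : ‖wordProd (W i).len (W i).fwd (W i).coef fun k => su2Quat (y ((W i).bd k))‖ ≤ 1 :=
    norm_wordProd_le hW fun k => (norm_su2Quat _).le
  exact (abs_le_of_sq_le_sq (by simpa using re_sq_le_norm_sq _) (norm_nonneg _)).trans h1

/-- **(hR)**, norm form. [folklore] -/
theorem norm_pathInsert_le (W : ι → LinkWord s) {i : ι} (hW : ∀ l, ‖(W i).coef l‖ ≤ 1) (y : ↥s → SU2) :
    ‖pathInsert W y i‖ ≤ 1 := by
  rw [Real.norm_eq_abs]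
  exact abs_pathInsert_le W hW y

/-- THE ONE-LETTER WORD `1 · p · dir i` of the link `bd i`. [folklore] -/
def oneLetter (bd : ι → ↥s) (dir : ι → ℍ) (i : ι) : LinkWord s :=
  ⟨1, fun _ => bd i, fun _ => true, ![1, dir i]⟩

/-- **CONSISTENCY WITH THE TRANSVERSE INSERT**: the path insert of the one-letter words `1 · p · dir i` is
`T4WilsonOddInsert.transverseInsert bd dir`. [folklore] -/
theorem pathInsert_oneLetter (bd : ι → ↥s) (dir : ι → ℍ) :
    pathInsert (oneLetter bd dir) = transverseInsert bd dir := by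
  funext y i
  rw [pathInsert_apply, transverseInsert_apply]
  show ((1 : ℍ) * letter true (su2Quat (y (bd i))) * dir i).re = _
  rw [letter_true, one_mul]

variable [DecidableEq (PBond P j)] {n : ℕ} {u₀ : GaugeField P j SU2}

/-- **(hBg) FOR THE PATH INSERT, ABOUT ANY REFERENCE**: for a word with cofactors of norm `≤ 1`, DISTINCT links and
at most `M` letters, `0 ≤ ρ`, `3S² ≤ ρ²`: the chart reading on `[−S,S]ⁿ` has a global `C¹` representative with
`|∇|² ≤ (√M · (1 + ρ + ρ²))²`. [folklore] -/
theorem chartRep_pathInsert (e : ↥s × Fin 3 ≃ Fin n) (W : ι → LinkWord s) {i : ι} (hW : ∀ l, ‖(W i).coef l‖ ≤ 1)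
    (hinj : Function.Injective (W i).bd) {M : ℕ} (hM : (W i).len ≤ M) {S ρ : ℝ} (hρ : 0 ≤ ρ)
    (h3S : 3 * S ^ 2 ≤ ρ ^ 2) :
    ∃ g : (Fin n → ℝ) → ℝ, ContDiff ℝ 1 g ∧
      (∀ x ∈ cube n S, g x = pathInsert W (gnoFibreChart s u₀ e x) i) ∧
      ∀ x ∈ cube n S, coordGradient g x ⬝ᵥ coordGradient g x ≤ (Real.sqrt M * (1 + ρ + ρ ^ 2)) ^ 2 := by
  obtain ⟨g, hg, hgB, hgL⟩ := chartRep_wordInsert (u₀ := u₀) e (W i).fwd hW hinj hρ h3S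
  refine ⟨g, hg, fun x hx => by rw [hgB x hx, pathInsert_apply], fun x hx => (hgL x hx).trans ?_⟩
  rw [mul_pow, Real.sq_sqrt (Nat.cast_nonneg M)]
  exact mul_le_mul_of_nonneg_right (Nat.cast_le.2 hM) (sq_nonneg _)

end Path

/-! ## §6  Centred inserts: `MeanVanishes` at the reference by construction -/

section Centred

variable {P : Params} {j : ℕ} [DecidableEq (PBond P j)] {s : Finset (PBond P j)} {ι : Type*}

/-- **THE CENTRED INSERT**: `B` minus its conditional mean at the reference exterior `u₀` under the weight `old`,
`(y, i) ↦ B y i − ∫ B y' i ∂condLaw s old u₀` (a constant shift per index). [folklore] -/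
def centredInsert (s : Finset (PBond P j)) (old : Density P j SU2) (u₀ : GaugeField P j SU2)
    (B : (↥s → SU2) → ι → ℝ) : (↥s → SU2) → ι → ℝ :=
  fun y i => B y i - ∫ y', B y' i ∂condLaw s old u₀

variable {old : Density P j SU2} {u₀ : GaugeField P j SU2}

/-- Unfolding lemma. [folklore] -/
theorem centredInsert_apply (B : (↥s → SU2) → ι → ℝ) (y : ↥s → SU2) (i : ι) :
    centredInsert s old u₀ B y i = B y i - ∫ y', B y' i ∂condLaw s old u₀ := rfl

/-- **(hBm)** is inherited. [folklore] -/
theorem measurable_centredInsert {B : (↥s → SU2) → ι → ℝ} {i : ι} (h : Measurable fun y => B y i) :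
    Measurable fun y => centredInsert s old u₀ B y i :=
  h.sub measurable_const

/-- A conditional mean of a function bounded by `R ≥ 0` is bounded by `R` (the conditional law is zero or a
probability measure). [folklore] -/
theorem norm_integral_condLaw_le {C : ℝ} (hC : ∀ U, old U ≤ C) (V : GaugeField P j SU2) {f : (↥s → SU2) → ℝ}
    {R : ℝ} (hR0 : 0 ≤ R) (hf : ∀ y, ‖f y‖ ≤ R) : ‖∫ y, f y ∂condLaw s old V‖ ≤ R := by
  haveI := isZeroOrProbabilityMeasure_condLaw s hC V
  exact (norm_integral_le_of_norm_le_const (Filter.Eventually.of_forall hf)).trans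
    (mul_le_of_le_one_right hR0 measureReal_le_one)

/-- **(hR)** for the centred insert: `‖B − E[B]‖ ≤ 2R`. [folklore] -/
theorem norm_centredInsert_le {C : ℝ} (hC : ∀ U, old U ≤ C) {B : (↥s → SU2) → ι → ℝ} {i : ι} {R : ℝ}
    (hR : ∀ y, ‖B y i‖ ≤ R) (y : ↥s → SU2) : ‖centredInsert s old u₀ B y i‖ ≤ 2 * R := by
  have hR0 : 0 ≤ R := (norm_nonneg _).trans (hR fun _ => 1)
  rw [centredInsert_apply]
  calc ‖B y i - ∫ y', B y' i ∂condLaw s old u₀‖ ≤ ‖B y i‖ + ‖∫ y', B y' i ∂condLaw s old u₀‖ := norm_sub_le _ _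
    _ ≤ R + R := add_le_add (hR y) (norm_integral_condLaw_le hC u₀ hR0 hR)
    _ = 2 * R := by ring

/-- **(hBg)** is inherited with the SAME Lipschitz modulus (a constant shift has the same gradient). [folklore] -/
theorem chartRep_centredInsert {n : ℕ} (e : ↥s × Fin 3 ≃ Fin n) {B : (↥s → SU2) → ι → ℝ} {i : ι} {S L : ℝ}
    (hBg : ∃ g : (Fin n → ℝ) → ℝ, ContDiff ℝ 1 g ∧
      (∀ x ∈ cube n S, g x = B (gnoFibreChart s u₀ e x) i) ∧
      ∀ x ∈ cube n S, coordGradient g x ⬝ᵥ coordGradient g x ≤ L ^ 2) :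
    ∃ g : (Fin n → ℝ) → ℝ, ContDiff ℝ 1 g ∧
      (∀ x ∈ cube n S, g x = centredInsert s old u₀ B (gnoFibreChart s u₀ e x) i) ∧
      ∀ x ∈ cube n S, coordGradient g x ⬝ᵥ coordGradient g x ≤ L ^ 2 := by
  obtain ⟨g, hg, hgB, hgL⟩ := hBg
  refine ⟨fun x => g x - ∫ y', B y' i ∂condLaw s old u₀, hg.sub contDiff_const,
    fun x hx => by simp only [centredInsert_apply, hgB x hx], fun x hx => ?_⟩
  have h : coordGradient (fun x => g x - ∫ y', B y' i ∂condLaw s old u₀) x = coordGradient g x := by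
    funext l
    simp only [coordGradient, fderiv_sub_const]
  rw [h]
  exact hgL x hx

/-- **`MeanVanishes` AT THE REFERENCE, BY CONSTRUCTION**: under the printed proviso (the conditional law at `u₀`
is a probability measure) the centred insert of a bounded measurable `B` has conditional mean `0` at `u₀` on `T`.
[folklore] -/
theorem meanVanishes_centredInsert {C : ℝ} (hC : ∀ U, old U ≤ C) (hne : fibreIntegral s old u₀ ≠ 0)
    {B : (↥s → SU2) → ι → ℝ} {T : Finset ι} (hBm : ∀ i ∈ T, Measurable fun y => B y i) {R : ℝ}
    (hR : ∀ i ∈ T, ∀ y, ‖B y i‖ ≤ R) :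
    MeanVanishes T fun i => ∫ y, centredInsert s old u₀ B y i ∂condLaw s old u₀ := by
  intro i hi
  haveI := isProbabilityMeasure_condLaw s hC u₀ hne
  have hint : Integrable (fun y => B y i) (condLaw s old u₀) :=
    Integrable.of_bound (hBm i hi).aestronglyMeasurable R (Filter.Eventually.of_forall (hR i hi))
  simp only [centredInsert_apply]
  rw [integral_sub hint (integrable_const _), integral_const, probReal_univ, one_smul, sub_self]

end Centred

/-! ## §7  The junction theorems -/

section Junction

variable {P : Params} {j : ℕ} [DecidableEq (PBond P j)] {s : Finset (PBond P j)} {u₀ : GaugeField P j SU2}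
variable {ε S : ℝ} {n : ℕ}

/-- **(J2c) `CondMeanSuppression` FOR CENTRED INSERTS, ANY REFERENCE — NO `MeanVanishes` BINDER.**  On a
plaquette-disjoint `s`, with the window numbers, the reference small field `hsf₀` (KEPT) and the insert data of `B`
(`hBm`, `hBg` with modulus `L`, `hR`): the conditional means of the CENTRED insert `B − E^{W}_s[B | (u₀)_out]` satisfy
`CondMeanSuppression` on `stapleLive s u₀ ε` with modulus `respSlope·(L/√respLam)`
(`condMeanSuppression_wilson_disjoint` with `hflat := meanVanishes_centredInsert`, `R := 2R`). [folklore] -/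
theorem condMeanSuppression_wilson_centred {ι : Type*} (hdis : PlaqDisjoint s) (e : ↥s × Fin 3 ≃ Fin n)
    (hS : 0 < S) {S' : ℝ} (hSS' : S < S') (hS'1 : S' ≤ 1) {β w : ℝ} (hβ : 0 ≤ β) (hw : 0 ≤ w) (hε0 : 0 ≤ ε)
    (hsf₀ : ∀ b ∈ s, ∀ p, IsLetter b p → 1 - ε ≤ reTr (GaugeField.plaqHol u₀ p))
    {ρ : ℝ} (hρ : 0 ≤ ρ) (hρ4 : ρ ≤ 1 / 4) (h3S : 3 * S' ^ 2 ≤ ρ ^ 2)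
    {B : (↥s → SU2) → ι → ℝ} {T : Finset ι} (hBm : ∀ i ∈ T, Measurable fun y => B y i) {L : ℝ} (hL : 0 ≤ L)
    (hBg : ∀ i ∈ T, ∃ g : (Fin n → ℝ) → ℝ, ContDiff ℝ 1 g ∧
      (∀ x ∈ cube n S, g x = B (gnoFibreChart s u₀ e x) i) ∧
      ∀ x ∈ cube n S, coordGradient g x ⬝ᵥ coordGradient g x ≤ L ^ 2)
    {R : ℝ} (hR : ∀ i ∈ T, ∀ y, ‖B y i‖ ≤ R) :
    CondMeanSuppression (stapleLive s u₀ ε)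
      (fun u i => ∫ y, centredInsert s (fun U => windowDensity s u₀ S U * Real.exp (-β * wilsonAction w U)) u₀ B y i
        ∂condLaw s (fun U => windowDensity s u₀ S U * Real.exp (-β * wilsonAction w U)) u)
      T (fun U => ∑ b : ↥s, stapleDist (b : PBond P j) u₀ U)
      (respSlope P β w ρ S' * (L / Real.sqrt (respLam P β w S'))) :=
  condMeanSuppression_wilson_disjoint hdis e hS hSS' hS'1 hβ hw hε0 hsf₀ hρ hρ4 h3S
    (fun i hi => measurable_centredInsert (hBm i hi)) hL (fun i hi => chartRep_centredInsert e (hBg i hi))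
    (R := 2 * R) (fun i hi y => norm_centredInsert_le (wilsonGibbs_le β w) (hR i hi) y)
    (meanVanishes_centredInsert (wilsonGibbs_le β w) (fibreIntegral_wilsonGibbs_ne_zero hS β w) hBm hR)

/-- **(J3c) THE (CM) CHANNEL (I6) FOR CENTRED INSERTS, ANY REFERENCE.**  Same data plus the coefficient bound: for
every exterior `V ∈ stapleLive s u₀ ε`,
`|E^{W}_s[linDensity t T a (fibreReading s (B − E^{W}_s[B | (u₀)_out])) | V_out]| ≤ |t|·(|T|·A·(respSlope·(L/√respLam)·(1/8 − ε)))`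
— NO `MeanVanishes` binder, NO oddness; the consumer's (EST) input is NOT claimed. [folklore] -/
theorem condMean_channel_wilson_centred {ι : Type*} (hdis : PlaqDisjoint s) (e : ↥s × Fin 3 ≃ Fin n) (hS : 0 < S)
    {S' : ℝ} (hSS' : S < S') (hS'1 : S' ≤ 1) {β w : ℝ} (hβ : 0 ≤ β) (hw : 0 ≤ w) (hε0 : 0 ≤ ε)
    (hsf₀ : ∀ b ∈ s, ∀ p, IsLetter b p → 1 - ε ≤ reTr (GaugeField.plaqHol u₀ p))
    {ρ : ℝ} (hρ : 0 ≤ ρ) (hρ4 : ρ ≤ 1 / 4) (h3S : 3 * S' ^ 2 ≤ ρ ^ 2)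
    {B : (↥s → SU2) → ι → ℝ} {T : Finset ι} (hBm : ∀ i ∈ T, Measurable fun y => B y i) {L : ℝ} (hL : 0 ≤ L)
    (hBg : ∀ i ∈ T, ∃ g : (Fin n → ℝ) → ℝ, ContDiff ℝ 1 g ∧
      (∀ x ∈ cube n S, g x = B (gnoFibreChart s u₀ e x) i) ∧
      ∀ x ∈ cube n S, coordGradient g x ⬝ᵥ coordGradient g x ≤ L ^ 2)
    {R : ℝ} (hR : ∀ i ∈ T, ∀ y, ‖B y i‖ ≤ R) (t : ℝ) {a : ι → ℝ} {A : ℝ} (hA : ∀ i ∈ T, ‖a i‖ ≤ A) :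
    ∀ V ∈ stapleLive s u₀ ε,
      |condMean s (fun U => windowDensity s u₀ S U * Real.exp (-β * wilsonAction w U))
          (linDensity t T a (fibreReading s
            (centredInsert s (fun U => windowDensity s u₀ S U * Real.exp (-β * wilsonAction w U)) u₀ B))) V|
        ≤ |t| * ((T.card : ℝ) * A * (respSlope P β w ρ S' * (L / Real.sqrt (respLam P β w S')) * (1 / 8 - ε))) :=
  condMean_channel_wilson_disjoint hdis e hS hSS' hS'1 hβ hw hε0 hsf₀ hρ hρ4 h3S
    (fun i hi => measurable_centredInsert (hBm i hi)) hL (fun i hi => chartRep_centredInsert e (hBg i hi))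
    (R := 2 * R) (fun i hi y => norm_centredInsert_le (wilsonGibbs_le β w) (hR i hi) y)
    (meanVanishes_centredInsert (wilsonGibbs_le β w) (fibreIntegral_wilsonGibbs_ne_zero hS β w) hBm hR) t hA

/-- **(J3c, FLAT REFERENCE) — NO LAW-SIDE HYPOTHESIS.**  About the flat field `u₀ = 1`, `ε = 0`
(`hsf₀ := smallField_flat`): for every `V` with `Σ_{b∈s} stapleDist b 1 V ≤ 1/8`,
`|E^{W}_s[linDensity t T a (fibreReading s (B − E^{W}_s[B | 1_out])) | V_out]| ≤ |t|·(|T|·A·(respSlope·(L/√respLam)·(1/8)))`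
from the window numbers, `0 ≤ β`, `0 ≤ w`, the insert data and the coefficient bound ONLY. [folklore] -/
theorem condMean_channel_wilson_centred_flat {ι : Type*} (hdis : PlaqDisjoint s) (e : ↥s × Fin 3 ≃ Fin n)
    (hS : 0 < S) {S' : ℝ} (hSS' : S < S') (hS'1 : S' ≤ 1) {β w : ℝ} (hβ : 0 ≤ β) (hw : 0 ≤ w) {ρ : ℝ}
    (hρ : 0 ≤ ρ) (hρ4 : ρ ≤ 1 / 4) (h3S : 3 * S' ^ 2 ≤ ρ ^ 2)
    {B : (↥s → SU2) → ι → ℝ} {T : Finset ι} (hBm : ∀ i ∈ T, Measurable fun y => B y i) {L : ℝ} (hL : 0 ≤ L)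
    (hBg : ∀ i ∈ T, ∃ g : (Fin n → ℝ) → ℝ, ContDiff ℝ 1 g ∧
      (∀ x ∈ cube n S, g x = B (gnoFibreChart s (1 : GaugeField P j SU2) e x) i) ∧
      ∀ x ∈ cube n S, coordGradient g x ⬝ᵥ coordGradient g x ≤ L ^ 2)
    {R : ℝ} (hR : ∀ i ∈ T, ∀ y, ‖B y i‖ ≤ R) (t : ℝ) {a : ι → ℝ} {A : ℝ} (hA : ∀ i ∈ T, ‖a i‖ ≤ A) :
    ∀ V ∈ stapleLive s (1 : GaugeField P j SU2) 0,
      |condMean s (fun U => windowDensity s (1 : GaugeField P j SU2) S U * Real.exp (-β * wilsonAction w U))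
          (linDensity t T a (fibreReading s
            (centredInsert s (fun U => windowDensity s (1 : GaugeField P j SU2) S U * Real.exp (-β * wilsonAction w U))
              1 B))) V|
        ≤ |t| * ((T.card : ℝ) * A * (respSlope P β w ρ S' * (L / Real.sqrt (respLam P β w S')) * (1 / 8))) := by
  intro V hV
  have h := condMean_channel_wilson_centred hdis e hS hSS' hS'1 hβ hw le_rfl (smallField_flat s) hρ hρ4 h3S hBm hL
    hBg hR t hA V hV
  simpa only [sub_zero] using h

/-- **(J1) FOR THE PATH INSERT, ANY REFERENCE.**  On a plaquette-disjoint `s`, with the window numbers, the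
reference small field `hsf₀` (KEPT) and, on `T`, words with cofactors of norm `≤ 1`, distinct links and at most `M`
letters: the conditional means of the path inserts are `MeanLipschitz` on `stapleLive s u₀ ε` with modulus
`respSlope·(√M(1+ρ+ρ²)/√respLam)` — `meanLipschitz_wilson_disjoint` with `hBm`, `hBg`, `hR` DISCHARGED. [folklore] -/
theorem meanLipschitz_wilson_path {ι : Type*} (hdis : PlaqDisjoint s) (hS : 0 < S) {S' : ℝ} (hSS' : S < S')
    (hS'1 : S' ≤ 1) {β w : ℝ} (hβ : 0 ≤ β) (hw : 0 ≤ w) (hε0 : 0 ≤ ε)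
    (hsf₀ : ∀ b ∈ s, ∀ p, IsLetter b p → 1 - ε ≤ reTr (GaugeField.plaqHol u₀ p))
    {ρ : ℝ} (hρ : 0 ≤ ρ) (hρ4 : ρ ≤ 1 / 4) (h3S : 3 * S' ^ 2 ≤ ρ ^ 2)
    (W : ι → LinkWord s) {T : Finset ι} {M : ℕ}
    (hW : ∀ i ∈ T, (∀ l, ‖(W i).coef l‖ ≤ 1) ∧ Function.Injective (W i).bd ∧ (W i).len ≤ M) :
    MeanLipschitz (stapleLive s u₀ ε)
      (fun u i => ∫ y, pathInsert W y i
        ∂condLaw s (fun U => windowDensity s u₀ S U * Real.exp (-β * wilsonAction w U)) u)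
      T u₀ (fun U => ∑ b : ↥s, stapleDist (b : PBond P j) u₀ U)
      (respSlope P β w ρ S' * ((Real.sqrt M * (1 + ρ + ρ ^ 2)) / Real.sqrt (respLam P β w S'))) := by
  have h3S0 : 3 * S ^ 2 ≤ ρ ^ 2 := by nlinarith [pow_le_pow_left₀ hS.le hSS'.le 2]
  exact meanLipschitz_wilson_disjoint hdis (bondCoordEquiv s) hS hSS' hS'1 hβ hw hε0 hsf₀ hρ hρ4 h3S
    (fun i _ => measurable_pathInsert W i) (by positivity)
    (fun i hi => chartRep_pathInsert (bondCoordEquiv s) W (hW i hi).1 (hW i hi).2.1 (hW i hi).2.2 hρ h3S0)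
    (R := 1) (fun i hi y => norm_pathInsert_le W (hW i hi).1 y)

/-- **(J1, FLAT REFERENCE) FOR THE PATH INSERT — NO FIELD HYPOTHESIS.** [folklore] -/
theorem meanLipschitz_wilson_path_flat {ι : Type*} (hdis : PlaqDisjoint s) (hS : 0 < S) {S' : ℝ} (hSS' : S < S')
    (hS'1 : S' ≤ 1) {β w : ℝ} (hβ : 0 ≤ β) (hw : 0 ≤ w) {ρ : ℝ} (hρ : 0 ≤ ρ) (hρ4 : ρ ≤ 1 / 4)
    (h3S : 3 * S' ^ 2 ≤ ρ ^ 2) (W : ι → LinkWord s) {T : Finset ι} {M : ℕ}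
    (hW : ∀ i ∈ T, (∀ l, ‖(W i).coef l‖ ≤ 1) ∧ Function.Injective (W i).bd ∧ (W i).len ≤ M) :
    MeanLipschitz (stapleLive s (1 : GaugeField P j SU2) 0)
      (fun u i => ∫ y, pathInsert W y i
        ∂condLaw s (fun U => windowDensity s (1 : GaugeField P j SU2) S U * Real.exp (-β * wilsonAction w U)) u)
      T 1 (fun U => ∑ b : ↥s, stapleDist (b : PBond P j) 1 U)
      (respSlope P β w ρ S' * ((Real.sqrt M * (1 + ρ + ρ ^ 2)) / Real.sqrt (respLam P β w S'))) :=
  meanLipschitz_wilson_path hdis hS hSS' hS'1 hβ hw le_rfl (smallField_flat s) hρ hρ4 h3S W hW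

/-- **(J3c) FOR THE CENTRED PATH INSERT, ANY REFERENCE.**  For every `V ∈ stapleLive s u₀ ε`,
`|E^{W}_s[linDensity t T a (fibreReading s (pathInsert W − E^{W}_s[pathInsert W | (u₀)_out])) | V_out]|
≤ |t|·(|T|·A·(respSlope·(√M(1+ρ+ρ²)/√respLam)·(1/8 − ε)))` — hypotheses: `PlaqDisjoint s`, the window numbers,
`0 ≤ β`, `0 ≤ w`, `hsf₀`, the word data on `T`, the coefficient bound. [folklore] -/
theorem condMean_channel_wilson_path_centred {ι : Type*} (hdis : PlaqDisjoint s) (hS : 0 < S) {S' : ℝ}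
    (hSS' : S < S') (hS'1 : S' ≤ 1) {β w : ℝ} (hβ : 0 ≤ β) (hw : 0 ≤ w) (hε0 : 0 ≤ ε)
    (hsf₀ : ∀ b ∈ s, ∀ p, IsLetter b p → 1 - ε ≤ reTr (GaugeField.plaqHol u₀ p))
    {ρ : ℝ} (hρ : 0 ≤ ρ) (hρ4 : ρ ≤ 1 / 4) (h3S : 3 * S' ^ 2 ≤ ρ ^ 2)
    (W : ι → LinkWord s) {T : Finset ι} {M : ℕ}
    (hW : ∀ i ∈ T, (∀ l, ‖(W i).coef l‖ ≤ 1) ∧ Function.Injective (W i).bd ∧ (W i).len ≤ M)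
    (t : ℝ) {a : ι → ℝ} {A : ℝ} (hA : ∀ i ∈ T, ‖a i‖ ≤ A) :
    ∀ V ∈ stapleLive s u₀ ε,
      |condMean s (fun U => windowDensity s u₀ S U * Real.exp (-β * wilsonAction w U))
          (linDensity t T a (fibreReading s
            (centredInsert s (fun U => windowDensity s u₀ S U * Real.exp (-β * wilsonAction w U)) u₀
              (pathInsert W)))) V|
        ≤ |t| * ((T.card : ℝ) * A *
          (respSlope P β w ρ S' * ((Real.sqrt M * (1 + ρ + ρ ^ 2)) / Real.sqrt (respLam P β w S')) * (1 / 8 - ε))) := by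
  have h3S0 : 3 * S ^ 2 ≤ ρ ^ 2 := by nlinarith [pow_le_pow_left₀ hS.le hSS'.le 2]
  exact condMean_channel_wilson_centred hdis (bondCoordEquiv s) hS hSS' hS'1 hβ hw hε0 hsf₀ hρ hρ4 h3S
    (fun i _ => measurable_pathInsert W i) (by positivity)
    (fun i hi => chartRep_pathInsert (bondCoordEquiv s) W (hW i hi).1 (hW i hi).2.1 (hW i hi).2.2 hρ h3S0)
    (R := 1) (fun i hi y => norm_pathInsert_le W (hW i hi).1 y) t hA

/-- **(J3c, FLAT REFERENCE) FOR THE CENTRED PATH INSERT — CLOSED.**  About the flat field, for every exterior `V`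
with `Σ_{b∈s} stapleDist b 1 V ≤ 1/8`:
`|E^{W}_s[linDensity t T a (fibreReading s (pathInsert W − E^{W}_s[pathInsert W | 1_out])) | V_out]|
≤ |t|·(|T|·A·(respSlope·(√M(1+ρ+ρ²)/√respLam)·(1/8)))`, `W = χ_{s,1,S}·e^{−β A_w}` — hypotheses: `PlaqDisjoint s`,
the window numbers, `0 ≤ β`, `0 ≤ w`, the word data on `T` (cofactors of norm `≤ 1`, distinct links, `≤ M`
letters) and the coefficient bound; NOTHING about the law, NO insert binder.  The consumer's (EST) input is NOT
claimed. [folklore] -/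
theorem condMean_channel_wilson_path_centred_flat {ι : Type*} (hdis : PlaqDisjoint s) (hS : 0 < S) {S' : ℝ}
    (hSS' : S < S') (hS'1 : S' ≤ 1) {β w : ℝ} (hβ : 0 ≤ β) (hw : 0 ≤ w) {ρ : ℝ} (hρ : 0 ≤ ρ) (hρ4 : ρ ≤ 1 / 4)
    (h3S : 3 * S' ^ 2 ≤ ρ ^ 2) (W : ι → LinkWord s) {T : Finset ι} {M : ℕ}
    (hW : ∀ i ∈ T, (∀ l, ‖(W i).coef l‖ ≤ 1) ∧ Function.Injective (W i).bd ∧ (W i).len ≤ M)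
    (t : ℝ) {a : ι → ℝ} {A : ℝ} (hA : ∀ i ∈ T, ‖a i‖ ≤ A) :
    ∀ V ∈ stapleLive s (1 : GaugeField P j SU2) 0,
      |condMean s (fun U => windowDensity s (1 : GaugeField P j SU2) S U * Real.exp (-β * wilsonAction w U))
          (linDensity t T a (fibreReading s
            (centredInsert s (fun U => windowDensity s (1 : GaugeField P j SU2) S U * Real.exp (-β * wilsonAction w U))
              1 (pathInsert W)))) V|
        ≤ |t| * ((T.card : ℝ) * A *
          (respSlope P β w ρ S' * ((Real.sqrt M * (1 + ρ + ρ ^ 2)) / Real.sqrt (respLam P β w S')) * (1 / 8))) := by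
  intro V hV
  have h := condMean_channel_wilson_path_centred hdis hS hSS' hS'1 hβ hw le_rfl (smallField_flat s) hρ hρ4 h3S W hW
    t hA V hV
  simpa only [sub_zero] using h

/-- **TWO-LINK EXAMPLE** (`m = 2`): for distinct links `b₁ ≠ b₂` of a plaquette-disjoint `s` and cofactors
`c₀, c₁, c₂` of norm `≤ 1`, the centred insert `Re(c₀ · U(b₁) · c₁ · U(b₂)* · c₂) − E^{W}_s[… | 1_out]` obeys the
flat-reference channel bound with `M = 2`. [folklore] -/
example (hdis : PlaqDisjoint s) (hS : 0 < S) {S' : ℝ} (hSS' : S < S') (hS'1 : S' ≤ 1) {β w : ℝ} (hβ : 0 ≤ β)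
    (hw : 0 ≤ w) {ρ : ℝ} (hρ : 0 ≤ ρ) (hρ4 : ρ ≤ 1 / 4) (h3S : 3 * S' ^ 2 ≤ ρ ^ 2) {b₁ b₂ : ↥s} (hb : b₁ ≠ b₂)
    {c₀ c₁ c₂ : ℍ} (h₀ : ‖c₀‖ ≤ 1) (h₁ : ‖c₁‖ ≤ 1) (h₂ : ‖c₂‖ ≤ 1) (t : ℝ) {a : Unit → ℝ} {A : ℝ}
    (hA : ∀ i ∈ (Finset.univ : Finset Unit), ‖a i‖ ≤ A) :
    ∀ V ∈ stapleLive s (1 : GaugeField P j SU2) 0,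
      |condMean s (fun U => windowDensity s (1 : GaugeField P j SU2) S U * Real.exp (-β * wilsonAction w U))
          (linDensity t Finset.univ a (fibreReading s
            (centredInsert s (fun U => windowDensity s (1 : GaugeField P j SU2) S U * Real.exp (-β * wilsonAction w U))
              1 (pathInsert fun _ : Unit => (⟨2, ![b₁, b₂], ![true, false], ![c₀, c₁, c₂]⟩ : LinkWord s))))) V|
        ≤ |t| * (((Finset.univ : Finset Unit).card : ℝ) * A *
          (respSlope P β w ρ S' * ((Real.sqrt (2 : ℕ) * (1 + ρ + ρ ^ 2)) / Real.sqrt (respLam P β w S')) * (1 / 8))) := by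
  refine condMean_channel_wilson_path_centred_flat hdis hS hSS' hS'1 hβ hw hρ hρ4 h3S _ (M := 2) (fun _ _ => ⟨?_, ?_, le_rfl⟩) t hA
  · intro l
    fin_cases l <;> assumption
  · intro k k' h
    fin_cases k <;> fin_cases k' <;> simp_all

/-- What the two-link insert reads: `Re(c₀ · su2Quat(y b₁) · c₁ · su2Quat(y b₂)* · c₂)`. [folklore] -/
example (b₁ b₂ : ↥s) (c₀ c₁ c₂ : ℍ) (y : ↥s → SU2) :
    pathInsert (fun _ : Unit => (⟨2, ![b₁, b₂], ![true, false], ![c₀, c₁, c₂]⟩ : LinkWord s)) y ()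
      = (c₀ * su2Quat (y b₁) * c₁ * star (su2Quat (y b₂)) * c₂).re := by
  rw [pathInsert_apply]
  show (c₀ * letter true (su2Quat (y b₁)) * (c₁ * letter false (su2Quat (y b₂)) * c₂)).re = _
  simp only [letter_true, letter_false, mul_assoc]

/-- DICTIONARY EXAMPLE: the real trace of the holonomy `y b₁ · g · (y b₂)⁻¹ · h` with two variable links and two
frozen links `g`, `h` IS the path insert of the word `⟨2, [b₁, b₂], [true, false], [1, su2Quat g, su2Quat h]⟩`
(`reTr = Re ∘ su2Quat` on `SU(2)`, `su2Quat U⁻¹ = (su2Quat U)*`). [folklore] -/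
example (b₁ b₂ : ↥s) (g h : SU2) (y : ↥s → SU2) :
    reTr (y b₁ * g * (y b₂)⁻¹ * h)
      = pathInsert (fun _ : Unit => (⟨2, ![b₁, b₂], ![true, false], ![1, su2Quat g, su2Quat h]⟩ : LinkWord s)) y () := by
  rw [pathInsert_apply, reTr_eq_re_su2Quat, su2Quat_mul, su2Quat_mul, su2Quat_mul, su2Quat_inv]
  show _ = ((1 : ℍ) * letter true (su2Quat (y b₁)) * (su2Quat g * letter false (su2Quat (y b₂)) * su2Quat h)).re
  simp only [letter_true, letter_false, one_mul, mul_assoc]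

/-- Non-vacuity of the live set: the flat exterior itself. [folklore] -/
example : (1 : GaugeField P j SU2) ∈ stapleLive s (1 : GaugeField P j SU2) 0 :=
  T4WilsonResponseJunction.self_mem_stapleLive.2 (by norm_num)

/-- Non-vacuity of the window numbers: `S = 1/8`, `S′ = 1/7`, `ρ = 1/4`. [folklore] -/
example : (0 : ℝ) < 1 / 8 ∧ (1 : ℝ) / 8 < 1 / 7 ∧ (1 : ℝ) / 7 ≤ 1 ∧ (0 : ℝ) ≤ 1 / 4 ∧ (1 : ℝ) / 4 ≤ 1 / 4 ∧
    3 * ((1 : ℝ) / 7) ^ 2 ≤ (1 / 4) ^ 2 := by norm_num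

end Junction

end Literature.MathematicalPhysics.QuantumFieldTheory.Balaban1983to89.T4WilsonPathInsert

end
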